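import Summits.QuantumFields.YangMills.Theorems.AllWindowsColdBoxBoxHighLineSmearedFPParity
import Mathlib
import HarnessLib

/-!
# TASK T-S5/U5 step (1b), brick T-S5.4e-3: the EXPLICIT CUBIC TERM of the odd part of `landauPhi` along the orbit, with a quintic
# remainder (LEAD sfw-p2 g77 routing (R2), 2026-08-29T18:10:48Z) — LINE-19 ⟨stmt-QuantumFields-24004⟩/⟨24335⟩, LINE-20 ⟨24336⟩

Free-hands work of width seat `ym-line-sfw-p2-w3` (g39, cell `ym-idea-1`), part 3 over ✓`…SmearedFPParityLink` (p736274) / `…SmearedFPParity`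
(the exact parity split `landauPhi H (U^{exp ia}) = phiEven + phiOdd`).  The ODD part is cubic to leading order; this file isolates that cubic
term as an explicit TRILINEAR form — a finite sum of products of legs, the shape the Gaussian Wick pairing (✓`…GaussianChartWick`) consumes for
`E_G[T₃²]` (SHELL-BUDGET / U5 third order):

* `linkQuad U p q := −½(|p|² + |q|²)·U − X(p)UX(q)` — the quadratic Taylor part of `linkEven` — with `‖linkEven − U − linkQuad‖ ≤ 10·m⁴`
  (`|cos t − 1 + t²/2| ≤ (5/96)t⁴`, Mathlib `Real.cos_bound`; `|sinc t − 1| ≤ t²/4`) and `‖linkQuad‖ ≤ 20·m²`;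
* `divQuad` (the quadratic part of `divEven`; `|divEven − divDefect U − divQuad| ≤ 80·m⁴`, `|divQuad| ≤ 160·m²`);
* **`phiCubic H U a := 2 Σ_{x∈I} Σ_c divQuad U a x c · divDefectLin U a x c`** — the cubic term `T₃`, ODD (`phiCubic_neg`), and at a
  Landau representative, per site, **`|phiOdd − phiCubic| ≤ Σ_x 149760·(m x)⁵`** (`abs_phiOdd_sub_phiCubic_le`).

Mathlib + tree only; no `sorry`.  HONEST LABEL: one brick of step (1b) of the XL stubs S5/U5 (not on S5's critical path; input of U5's third
order); T-S5.4 proper, S5, U5, ⟨24004⟩ ⟨24335⟩ ⟨24336⟩ remain OPEN; no crux, rung or summit is proved; the Yang–Mills mass gap is NOT proved by this file.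
-/

set_option autoImplicit false

noncomputable section

open Matrix Finset
open scoped Matrix.Norms.Operator
open Literature.MathematicalPhysics.QuantumFieldTheory.Balaban1983to89.B10Eq18SigmaSU2 (su2Coord)
open Literature.MathematicalPhysics.QuantumFieldTheory.Balaban1983to89.B10Eq18SigmaSU2Haar (expPauli)
open Literature.MathematicalPhysics.QuantumLattice (LGConfig ZdEdge gaugeTransformZd)
open Literature.Probability.LatticeModels (Site)

namespace Summit.QuantumFields.YangMills.Theorems.AllWindowsColdBoxBoxHighLine

namespace Parity

/-! ## The quadratic Taylor part of the even link -/

/-- `|cos t − 1 + t²/2| ≤ t⁴/12` for `|t| ≤ 1`, stated with products (from Mathlib's `Real.cos_bound`, constant `5/96 ≤ 1/12`). -/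
theorem abs_cos_sub_one_add_sq_half_le {t : ℝ} (ht : |t| ≤ 1) : |Real.cos t - 1 + t * t / 2| ≤ t * t * (t * t) / 12 := by
  have h := Real.cos_bound ht
  have e : Real.cos t - 1 + t * t / 2 = Real.cos t - (1 - t ^ 2 / 2) := by ring
  rw [e]
  have h4 : |t| ^ 4 = t * t * (t * t) := by
    rw [show (4 : ℕ) = 2 * 2 by norm_num, pow_mul, sq_abs]; ring
  rw [h4] at h
  nlinarith [mul_self_nonneg (t * t)]

/-- QUADRATIC TAYLOR PART of `linkEven`: `−½(|p|² + |q|²)·U − X(p)UX(q)`. [problem-side definition] -/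
def linkQuad (U : Matrix (Fin 2) (Fin 2) ℂ) (p q : EuclideanSpace ℝ (Fin 3)) : Matrix (Fin 2) (Fin 2) ℂ :=
  -((((‖p‖ * ‖p‖ + ‖q‖ * ‖q‖) / 2 : ℝ) : ℂ) • U) - su2Coord p * U * su2Coord q

/-- `linkQuad` is even. -/
theorem linkQuad_neg (U : Matrix (Fin 2) (Fin 2) ℂ) (p q : EuclideanSpace ℝ (Fin 3)) : linkQuad U (-p) (-q) = linkQuad U p q := by
  simp only [linkQuad, norm_neg, WithLp.ofLp_neg, su2Coord_neg, neg_mul, mul_neg, neg_neg]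

section LinkBounds

variable {U : Matrix (Fin 2) (Fin 2) ℂ} {p q : EuclideanSpace ℝ (Fin 3)} {m : ℝ}

/-- `‖linkQuad‖ ≤ 20·m²`. -/
theorem norm_linkQuad_le (hU : ‖U‖ ≤ 2) (hp : ‖p‖ ≤ m) (hq : ‖q‖ ≤ m) : ‖linkQuad U p q‖ ≤ 20 * m ^ 2 := by
  have hm0 : 0 ≤ m := (norm_nonneg p).trans hp
  have hp2 : ‖p‖ * ‖p‖ ≤ m ^ 2 := by rw [sq]; exact mul_le_mul hp hp (norm_nonneg _) hm0
  have hq2 : ‖q‖ * ‖q‖ ≤ m ^ 2 := by rw [sq]; exact mul_le_mul hq hq (norm_nonneg _) hm0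
  have b3 : ‖su2Coord p * U * su2Coord q‖ ≤ 18 * m ^ 2 := by
    have h1 := norm_su2Coord_mul_le hU hp
    have h2 := norm_su2Coord_le q
    calc ‖su2Coord p * U * su2Coord q‖ ≤ ‖su2Coord p * U‖ * ‖su2Coord q‖ := norm_mul_le _ _
      _ ≤ (6 * m) * (3 * ‖q‖) := mul_le_mul h1 h2 (norm_nonneg _) (by positivity)
      _ ≤ (6 * m) * (3 * m) := by nlinarith
      _ = 18 * m ^ 2 := by ring
  unfold linkQuad
  refine (norm_sub_le _ _).trans ?_
  rw [norm_neg, norm_smul, Complex.norm_real, Real.norm_eq_abs, abs_of_nonneg (by positivity)]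
  have t1 : (‖p‖ * ‖p‖ + ‖q‖ * ‖q‖) / 2 * ‖U‖ ≤ m ^ 2 * 2 :=
    mul_le_mul (by linarith) hU (norm_nonneg _) (by positivity)
  linarith

/-- **`linkEven` minus its Taylor polynomial of order 2 is quartic**: `‖linkEven − U − linkQuad‖ ≤ 10·m⁴` (`|p|, |q| ≤ m ≤ 1`). -/
theorem norm_linkEven_sub_sub_linkQuad_le (hU : ‖U‖ ≤ 2) (hp : ‖p‖ ≤ m) (hq : ‖q‖ ≤ m) (hm : m ≤ 1) :
    ‖linkEven U p q - U - linkQuad U p q‖ ≤ 10 * m ^ 4 := by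
  have hm0 : 0 ≤ m := (norm_nonneg p).trans hp
  have hp1 : |‖p‖| ≤ 1 := by rw [abs_of_nonneg (norm_nonneg _)]; linarith
  have hq1 : |‖q‖| ≤ 1 := by rw [abs_of_nonneg (norm_nonneg _)]; linarith
  have hp2 : ‖p‖ * ‖p‖ ≤ m ^ 2 := by rw [sq]; exact mul_le_mul hp hp (norm_nonneg _) hm0
  have hq2 : ‖q‖ * ‖q‖ ≤ m ^ 2 := by rw [sq]; exact mul_le_mul hq hq (norm_nonneg _) hm0
  -- scalar errors
  have ec : |Real.cos ‖p‖ * Real.cos ‖q‖ - 1 + (‖p‖ * ‖p‖ + ‖q‖ * ‖q‖) / 2| ≤ m ^ 4 / 2 := by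
    have h1 : Real.cos ‖p‖ * Real.cos ‖q‖ - 1 + (‖p‖ * ‖p‖ + ‖q‖ * ‖q‖) / 2
        = (Real.cos ‖p‖ - 1) * (Real.cos ‖q‖ - 1) + (Real.cos ‖p‖ - 1 + ‖p‖ * ‖p‖ / 2) + (Real.cos ‖q‖ - 1 + ‖q‖ * ‖q‖ / 2) := by ring
    rw [h1]
    have a1 := abs_cos_sub_one_le' ‖p‖
    have a2 := abs_cos_sub_one_le' ‖q‖
    have a3 := abs_cos_sub_one_add_sq_half_le hp1
    have a4 := abs_cos_sub_one_add_sq_half_le hq1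
    have a5 : |(Real.cos ‖p‖ - 1) * (Real.cos ‖q‖ - 1)| ≤ (‖p‖ * ‖p‖ / 2) * (‖q‖ * ‖q‖ / 2) := by
      rw [abs_mul]; exact mul_le_mul a1 a2 (abs_nonneg _) (by positivity)
    have s1 : (‖p‖ * ‖p‖ / 2) * (‖q‖ * ‖q‖ / 2) ≤ m ^ 4 / 4 := by
      have := mul_le_mul hp2 hq2 (by positivity) (by positivity); nlinarith
    have s2 : ‖p‖ * ‖p‖ * (‖p‖ * ‖p‖) / 12 ≤ m ^ 4 / 12 := by
      have := mul_le_mul hp2 hp2 (by positivity) (by positivity); nlinarith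
    have s3 : ‖q‖ * ‖q‖ * (‖q‖ * ‖q‖) / 12 ≤ m ^ 4 / 12 := by
      have := mul_le_mul hq2 hq2 (by positivity) (by positivity); nlinarith
    calc |(Real.cos ‖p‖ - 1) * (Real.cos ‖q‖ - 1) + (Real.cos ‖p‖ - 1 + ‖p‖ * ‖p‖ / 2) + (Real.cos ‖q‖ - 1 + ‖q‖ * ‖q‖ / 2)|
        ≤ |(Real.cos ‖p‖ - 1) * (Real.cos ‖q‖ - 1)| + |Real.cos ‖p‖ - 1 + ‖p‖ * ‖p‖ / 2| + |Real.cos ‖q‖ - 1 + ‖q‖ * ‖q‖ / 2| :=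
          abs_add_three _ _ _
      _ ≤ m ^ 4 / 4 + m ^ 4 / 12 + m ^ 4 / 12 := by linarith
      _ ≤ m ^ 4 / 2 := by nlinarith [pow_nonneg hm0 4]
  have es : |Real.sinc ‖p‖ * Real.sinc ‖q‖ - 1| ≤ m ^ 2 / 2 := by
    have h1 : Real.sinc ‖p‖ * Real.sinc ‖q‖ - 1 = (Real.sinc ‖p‖ - 1) * Real.sinc ‖q‖ + (Real.sinc ‖q‖ - 1) := by ring
    rw [h1]
    refine (abs_add_le _ _).trans ?_
    rw [abs_mul]
    have a1 := abs_sinc_sub_one_le' hp1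
    have a2 := abs_sinc_le ‖q‖
    have a3 := abs_sinc_sub_one_le' hq1
    have : |Real.sinc ‖p‖ - 1| * |Real.sinc ‖q‖| ≤ ‖p‖ * ‖p‖ / 4 * 1 := mul_le_mul a1 a2 (abs_nonneg _) (by positivity)
    linarith
  have b3 : ‖su2Coord p * U * su2Coord q‖ ≤ 18 * m ^ 2 := by
    have h1 := norm_su2Coord_mul_le hU hp
    have h2 := norm_su2Coord_le q
    calc ‖su2Coord p * U * su2Coord q‖ ≤ ‖su2Coord p * U‖ * ‖su2Coord q‖ := norm_mul_le _ _
      _ ≤ (6 * m) * (3 * ‖q‖) := mul_le_mul h1 h2 (norm_nonneg _) (by positivity)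
      _ ≤ (6 * m) * (3 * m) := by nlinarith
      _ = 18 * m ^ 2 := by ring
  -- the difference
  have hdiff : linkEven U p q - U - linkQuad U p q
      = ((Real.cos ‖p‖ * Real.cos ‖q‖ - 1 + (‖p‖ * ‖p‖ + ‖q‖ * ‖q‖) / 2 : ℝ) : ℂ) • U
        - ((Real.sinc ‖p‖ * Real.sinc ‖q‖ - 1 : ℝ) : ℂ) • (su2Coord p * U * su2Coord q) := by
    simp only [linkEven, linkQuad, Complex.ofReal_sub, Complex.ofReal_add, Complex.ofReal_one, sub_smul, add_smul, one_smul]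
    abel
  rw [hdiff]
  refine (norm_sub_le _ _).trans ?_
  rw [norm_smul, norm_smul, Complex.norm_real, Complex.norm_real, Real.norm_eq_abs, Real.norm_eq_abs]
  have t1 : |Real.cos ‖p‖ * Real.cos ‖q‖ - 1 + (‖p‖ * ‖p‖ + ‖q‖ * ‖q‖) / 2| * ‖U‖ ≤ (m ^ 4 / 2) * 2 :=
    mul_le_mul ec hU (norm_nonneg _) (by positivity)
  have t2 : |Real.sinc ‖p‖ * Real.sinc ‖q‖ - 1| * ‖su2Coord p * U * su2Coord q‖ ≤ (m ^ 2 / 2) * (18 * m ^ 2) :=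
    mul_le_mul es b3 (norm_nonneg _) (by positivity)
  nlinarith [pow_nonneg hm0 4]

end LinkBounds

/-! ## The quadratic part of the divergence defect -/

/-- The quadratic part of the link `e` of `U^{exp ia}`. [problem-side definition] -/
def linkQuadAt (U : LGConfig 4 SU2) (a : Site 4 → EuclideanSpace ℝ (Fin 3)) (e : ZdEdge 4) : Matrix (Fin 2) (Fin 2) ℂ :=
  linkQuad (U e : Matrix (Fin 2) (Fin 2) ℂ) (a e.1) (a (e.1 + Pi.single e.2 1))

/-- QUADRATIC part of `divEven` (a quadratic form in the field `a`). [problem-side definition] -/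
def divQuad (U : LGConfig 4 SU2) (a : Site 4 → EuclideanSpace ℝ (Fin 3)) (x : Site 4) : Fin 3 → ℝ :=
  ∑ μ : Fin 4, (imVecM (linkQuadAt U a (x - Pi.single μ 1, μ)) - imVecM (linkQuadAt U a (x, μ)))

/-- Componentwise formula for `divQuad`. -/
theorem divQuad_apply (U : LGConfig 4 SU2) (a : Site 4 → EuclideanSpace ℝ (Fin 3)) (x : Site 4) (c : Fin 3) :
    divQuad U a x c = ∑ μ : Fin 4, (imVecM (linkQuadAt U a (x - Pi.single μ 1, μ)) c - imVecM (linkQuadAt U a (x, μ)) c) := by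
  simp only [divQuad, Finset.sum_apply, Pi.sub_apply]

/-- `divQuad` is even in the field. -/
theorem divQuad_neg (U : LGConfig 4 SU2) (a : Site 4 → EuclideanSpace ℝ (Fin 3)) (x : Site 4) : divQuad U (-a) x = divQuad U a x := by
  simp only [divQuad, linkQuadAt, Pi.neg_apply, linkQuad_neg]

section SiteBounds

variable {U : LGConfig 4 SU2} {a : Site 4 → EuclideanSpace ℝ (Fin 3)} {x : Site 4} {m : ℝ}

/-- `|divQuad U a x c| ≤ 160·m²`. -/
theorem abs_divQuad_le (hx : ‖a x‖ ≤ m) (hnb : ∀ μ : Fin 4, ‖a (x - Pi.single μ 1)‖ ≤ m ∧ ‖a (x + Pi.single μ 1)‖ ≤ m) (c : Fin 3) :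
    |divQuad U a x c| ≤ 160 * m ^ 2 := by
  rw [divQuad_apply]
  have hterm : ∀ μ : Fin 4, |imVecM (linkQuadAt U a (x - Pi.single μ 1, μ)) c - imVecM (linkQuadAt U a (x, μ)) c| ≤ 20 * m ^ 2 + 20 * m ^ 2 := by
    intro μ
    refine (abs_sub _ _).trans (add_le_add ?_ ?_)
    · refine (abs_imVecM_le_norm _ c).trans ?_
      have hq : ‖a ((x - Pi.single μ 1) + Pi.single μ 1)‖ ≤ m := by rw [sub_add_cancel]; exact hx
      exact norm_linkQuad_le (norm_coe_le_two _) (hnb μ).1 hq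
    · exact (abs_imVecM_le_norm _ c).trans (norm_linkQuad_le (norm_coe_le_two _) hx (hnb μ).2)
  calc |∑ μ : Fin 4, (imVecM (linkQuadAt U a (x - Pi.single μ 1, μ)) c - imVecM (linkQuadAt U a (x, μ)) c)|
      ≤ ∑ μ : Fin 4, |imVecM (linkQuadAt U a (x - Pi.single μ 1, μ)) c - imVecM (linkQuadAt U a (x, μ)) c| :=
        Finset.abs_sum_le_sum_abs _ _
    _ ≤ ∑ _μ : Fin 4, (20 * m ^ 2 + 20 * m ^ 2) := Finset.sum_le_sum fun μ _ => hterm μ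
    _ = 160 * m ^ 2 := by simp; ring

/-- **`divEven − divDefect U − divQuad` is quartic**: `≤ 80·m⁴`. -/
theorem abs_divEven_sub_divDefect_sub_divQuad_le (hx : ‖a x‖ ≤ m)
    (hnb : ∀ μ : Fin 4, ‖a (x - Pi.single μ 1)‖ ≤ m ∧ ‖a (x + Pi.single μ 1)‖ ≤ m) (hm : m ≤ 1) (c : Fin 3) :
    |divEven U a x c - divDefect U x c - divQuad U a x c| ≤ 80 * m ^ 4 := by
  rw [divEven_apply, divDefect_apply, divQuad_apply, ← Finset.sum_sub_distrib, ← Finset.sum_sub_distrib]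
  have hterm : ∀ μ : Fin 4,
      |imVecM (linkEvenAt U a (x - Pi.single μ 1, μ)) c - imVecM (linkEvenAt U a (x, μ)) c
        - (imVec (U (x - Pi.single μ 1, μ)) c - imVec (U (x, μ)) c)
        - (imVecM (linkQuadAt U a (x - Pi.single μ 1, μ)) c - imVecM (linkQuadAt U a (x, μ)) c)| ≤ 10 * m ^ 4 + 10 * m ^ 4 := by
    intro μ
    rw [imVec_eq_imVecM, imVec_eq_imVecM]
    set e₁ : ZdEdge 4 := (x - Pi.single μ 1, μ)
    set e₂ : ZdEdge 4 := (x, μ)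
    have h1 : imVecM (linkEvenAt U a e₁) c - imVecM ((U e₁ : Matrix (Fin 2) (Fin 2) ℂ)) c - imVecM (linkQuadAt U a e₁) c
        = imVecM (linkEvenAt U a e₁ - (U e₁ : Matrix (Fin 2) (Fin 2) ℂ) - linkQuadAt U a e₁) c := by
      rw [imVecM_sub, imVecM_sub]; rfl
    have h2 : imVecM (linkEvenAt U a e₂) c - imVecM ((U e₂ : Matrix (Fin 2) (Fin 2) ℂ)) c - imVecM (linkQuadAt U a e₂) c
        = imVecM (linkEvenAt U a e₂ - (U e₂ : Matrix (Fin 2) (Fin 2) ℂ) - linkQuadAt U a e₂) c := by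
      rw [imVecM_sub, imVecM_sub]; rfl
    have b1 : |imVecM (linkEvenAt U a e₁ - (U e₁ : Matrix (Fin 2) (Fin 2) ℂ) - linkQuadAt U a e₁) c| ≤ 10 * m ^ 4 := by
      refine (abs_imVecM_le_norm _ c).trans ?_
      have hq : ‖a ((x - Pi.single μ 1) + Pi.single μ 1)‖ ≤ m := by rw [sub_add_cancel]; exact hx
      exact norm_linkEven_sub_sub_linkQuad_le (norm_coe_le_two _) (hnb μ).1 hq hm
    have b2 : |imVecM (linkEvenAt U a e₂ - (U e₂ : Matrix (Fin 2) (Fin 2) ℂ) - linkQuadAt U a e₂) c| ≤ 10 * m ^ 4 := by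
      refine (abs_imVecM_le_norm _ c).trans ?_
      exact norm_linkEven_sub_sub_linkQuad_le (norm_coe_le_two _) hx (hnb μ).2 hm
    calc |imVecM (linkEvenAt U a e₁) c - imVecM (linkEvenAt U a e₂) c
          - (imVecM ((U e₁ : Matrix (Fin 2) (Fin 2) ℂ)) c - imVecM ((U e₂ : Matrix (Fin 2) (Fin 2) ℂ)) c)
          - (imVecM (linkQuadAt U a e₁) c - imVecM (linkQuadAt U a e₂) c)|
        = |(imVecM (linkEvenAt U a e₁) c - imVecM ((U e₁ : Matrix (Fin 2) (Fin 2) ℂ)) c - imVecM (linkQuadAt U a e₁) c)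
            - (imVecM (linkEvenAt U a e₂) c - imVecM ((U e₂ : Matrix (Fin 2) (Fin 2) ℂ)) c - imVecM (linkQuadAt U a e₂) c)| := by
          ring_nf
      _ ≤ |imVecM (linkEvenAt U a e₁) c - imVecM ((U e₁ : Matrix (Fin 2) (Fin 2) ℂ)) c - imVecM (linkQuadAt U a e₁) c|
            + |imVecM (linkEvenAt U a e₂) c - imVecM ((U e₂ : Matrix (Fin 2) (Fin 2) ℂ)) c - imVecM (linkQuadAt U a e₂) c| :=
          abs_sub _ _
      _ ≤ 10 * m ^ 4 + 10 * m ^ 4 := by rw [h1, h2]; exact add_le_add b1 b2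
  calc |∑ μ : Fin 4, (imVecM (linkEvenAt U a (x - Pi.single μ 1, μ)) c - imVecM (linkEvenAt U a (x, μ)) c
          - (imVec (U (x - Pi.single μ 1, μ)) c - imVec (U (x, μ)) c)
          - (imVecM (linkQuadAt U a (x - Pi.single μ 1, μ)) c - imVecM (linkQuadAt U a (x, μ)) c))|
      ≤ ∑ μ : Fin 4, |imVecM (linkEvenAt U a (x - Pi.single μ 1, μ)) c - imVecM (linkEvenAt U a (x, μ)) c
          - (imVec (U (x - Pi.single μ 1, μ)) c - imVec (U (x, μ)) c)
          - (imVecM (linkQuadAt U a (x - Pi.single μ 1, μ)) c - imVecM (linkQuadAt U a (x, μ)) c)| :=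
        Finset.abs_sum_le_sum_abs _ _
    _ ≤ ∑ _μ : Fin 4, (10 * m ^ 4 + 10 * m ^ 4) := Finset.sum_le_sum fun μ _ => hterm μ
    _ = 80 * m ^ 4 := by simp; ring

/-- **At a Landau representative, per site and colour**: `|2·divEven·divOdd − 2·divQuad·divDefectLin| ≤ 49920·m⁵`. -/
theorem abs_two_mul_even_mul_odd_sub_cubic_le (hL : divDefect U x = 0) (hx : ‖a x‖ ≤ m)
    (hnb : ∀ μ : Fin 4, ‖a (x - Pi.single μ 1)‖ ≤ m ∧ ‖a (x + Pi.single μ 1)‖ ≤ m) (hm : m ≤ 1) (c : Fin 3) :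
    |2 * (divEven U a x c * divOdd U a x c) - 2 * (divQuad U a x c * divDefectLin U a x c)| ≤ 49920 * m ^ 5 := by
  have hm0 : 0 ≤ m := (norm_nonneg _).trans hx
  have hE4 := abs_divEven_sub_divDefect_sub_divQuad_le (U := U) hx hnb hm c
  rw [hL, Pi.zero_apply, sub_zero] at hE4
  have hQ := abs_divQuad_le (U := U) hx hnb c
  have hO := abs_divOdd_sub_divDefectLin_le (U := U) hx hnb hm c
  have hLin := abs_divDefectLin_le (U := U) hx hnb c
  set E := divEven U a x c
  set O := divOdd U a x c
  set Q := divQuad U a x c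
  set L := divDefectLin U a x c
  have hm3 : m ^ 3 ≤ m := by
    calc m ^ 3 = m * (m * m) := by ring
      _ ≤ m * (1 * 1) := mul_le_mul_of_nonneg_left (mul_le_mul hm hm hm0 zero_le_one) hm0
      _ = m := by ring
  have hOabs : |O| ≤ 168 * m := by
    have := abs_sub_abs_le_abs_sub O L
    nlinarith
  -- `E·O − Q·L = Q·(O − L) + (E − Q)·O`
  have e : 2 * (E * O) - 2 * (Q * L) = 2 * (Q * (O - L) + (E - Q) * O) := by ring
  rw [e, abs_mul, abs_two]
  have h1 : |Q * (O - L)| ≤ (160 * m ^ 2) * (72 * m ^ 3) := by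
    rw [abs_mul]; exact mul_le_mul hQ hO (abs_nonneg _) (by positivity)
  have h2 : |(E - Q) * O| ≤ (80 * m ^ 4) * (168 * m) := by
    rw [abs_mul]; exact mul_le_mul hE4 hOabs (abs_nonneg _) (by positivity)
  calc 2 * |Q * (O - L) + (E - Q) * O| ≤ 2 * (|Q * (O - L)| + |(E - Q) * O|) :=
        mul_le_mul_of_nonneg_left (abs_add_le _ _) (by norm_num)
    _ ≤ 2 * ((160 * m ^ 2) * (72 * m ^ 3) + (80 * m ^ 4) * (168 * m)) := by linarith
    _ = 49920 * m ^ 5 := by ring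

end SiteBounds

/-! ## The cubic term of `phiOdd` -/

/-- ★ **THE CUBIC TERM `T₃`** of the odd part of `landauPhi` along the orbit: the TRILINEAR form
`phiCubic H U a = 2 Σ_{x interior} Σ_c divQuad U a x c · divDefectLin U a x c` (quadratic part of the even divergence times the linear odd
divergence — a finite sum of products of legs). [problem-side definition] -/
def phiCubic (H : ℕ) (U : LGConfig 4 SU2) (a : Site 4 → EuclideanSpace ℝ (Fin 3)) : ℝ :=
  ∑ x ∈ interiorSites H, ∑ c : Fin 3, 2 * (divQuad U a x c * divDefectLin U a x c)

/-- `divDefectLin` is odd in the field. -/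
theorem divDefectLin_neg (U : LGConfig 4 SU2) (a : Site 4 → EuclideanSpace ℝ (Fin 3)) (x : Site 4) :
    divDefectLin U (-a) x = -divDefectLin U a x := by
  have h := divDefectLin_smul U (-1) a x
  rwa [neg_one_smul, neg_one_smul] at h

/-- ★ `phiCubic` is ODD in the field. -/
theorem phiCubic_neg (H : ℕ) (U : LGConfig 4 SU2) (a : Site 4 → EuclideanSpace ℝ (Fin 3)) : phiCubic H U (-a) = -phiCubic H U a := by
  simp only [phiCubic, divQuad_neg, divDefectLin_neg, Pi.neg_apply, mul_neg, ← Finset.sum_neg_distrib]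

/-- ★★ **THE ODD PART IS THE CUBIC TERM UP TO A QUINTIC ERROR, per site**, at a Landau representative:
`|phiOdd − phiCubic| ≤ Σ_x 149760·(m x)⁵`. -/
theorem abs_phiOdd_sub_phiCubic_le (H : ℕ) (U : LGConfig 4 SU2) (a : Site 4 → EuclideanSpace ℝ (Fin 3)) (m : Site 4 → ℝ)
    (hL : ∀ x ∈ interiorSites H, divDefect U x = 0)
    (hm : ∀ x ∈ interiorSites H, ‖a x‖ ≤ m x ∧ (∀ μ : Fin 4, ‖a (x - Pi.single μ 1)‖ ≤ m x ∧ ‖a (x + Pi.single μ 1)‖ ≤ m x) ∧ m x ≤ 1) :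
    |phiOdd H U a - phiCubic H U a| ≤ ∑ x ∈ interiorSites H, 149760 * m x ^ 5 := by
  unfold phiOdd phiCubic
  rw [← Finset.sum_sub_distrib]
  refine (Finset.abs_sum_le_sum_abs _ _).trans (Finset.sum_le_sum fun x hx => ?_)
  obtain ⟨h1, h2, h3⟩ := hm x hx
  rw [← Finset.sum_sub_distrib]
  refine (Finset.abs_sum_le_sum_abs _ _).trans ?_
  calc ∑ c : Fin 3, |2 * (divEven U a x c * divOdd U a x c) - 2 * (divQuad U a x c * divDefectLin U a x c)|
      ≤ ∑ _c : Fin 3, 49920 * m x ^ 5 := Finset.sum_le_sum fun c _ => abs_two_mul_even_mul_odd_sub_cubic_le (hL x hx) h1 h2 h3 c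
    _ = 149760 * m x ^ 5 := by simp; ring

/-- ★★ **Sup-norm form**: `|phiOdd − phiCubic| ≤ |I|·149760·M⁵` for interior Pauli coordinates of length `≤ M ≤ 1`. -/
theorem abs_phiOdd_sub_phiCubic_le_sup (H : ℕ) (U : LGConfig 4 SU2) (hL : ∀ x ∈ interiorSites H, divDefect U x = 0)
    (v : ↥(interiorSites H) × Fin 3 → ℝ) (M : ℝ) (hM0 : 0 ≤ M) (hM1 : M ≤ 1) (hv : ∀ y, ‖vecToField H v y‖ ≤ M) :
    |phiOdd H U (extPauli H (vecToField H v)) - phiCubic H U (extPauli H (vecToField H v))| ≤ (interiorSites H).card * (149760 * M ^ 5) := by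
  have hm : ∀ x ∈ interiorSites H, ‖extPauli H (vecToField H v) x‖ ≤ M ∧
      (∀ μ : Fin 4, ‖extPauli H (vecToField H v) (x - Pi.single μ 1)‖ ≤ M ∧ ‖extPauli H (vecToField H v) (x + Pi.single μ 1)‖ ≤ M) ∧
      M ≤ 1 := fun x _ =>
    ⟨norm_extPauli_le hM0 hv _, fun μ => ⟨norm_extPauli_le hM0 hv _, norm_extPauli_le hM0 hv _⟩, hM1⟩
  refine (abs_phiOdd_sub_phiCubic_le H U _ (fun _ => M) hL hm).trans (le_of_eq ?_)
  rw [Finset.sum_const, nsmul_eq_mul]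

end Parity

end Summit.QuantumFields.YangMills.Theorems.AllWindowsColdBoxBoxHighLine

end
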